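import Literature.AlgebraicGeometry.Resolution.CanonicalResolutionSmoothCentre
import Literature.AlgebraicGeometry.Resolution.BlowupSequencesExtensions
import Literature.AlgebraicGeometry.Resolution.MarkedIdealsEtale
import HarnessLib

/-!
# The output of BGMW Thm. 8.0.5 for `(𝔸ⁿ_k, (S), ∅, 1)` as a datum, and the assembly of `BierstoneGrigorievMilmanWlodarczyk2011_canonical` from it

Topic: `Literature/AlgebraicGeometry/Resolution`. The INTERFACE between the resolution
algorithm (Bierstone–Grigoriev–Milman–Włodarczyk, arXiv:1206.3090, §4 / Thm. 4.0.6, run in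
characteristic `p > M̄`, Thm. 8.0.5; size XL, not in the tree) and the named fact
`BierstoneGrigorievMilmanWlodarczyk2011_canonical` (`CanonicalResolution.lean`): what the
algorithm has to deliver, for ONE input `Y = V(S) ⊆ 𝔸ⁿ_k`, in the data-level vocabulary of the
tree (`CentreSeq`, `IsResolutionOf`, `CentreSeq.restrict`, `CentreSeq.IsExtensionOf`,
`IsExtensionOfSingle`, `MarkedIdeal.comap`), and the PROOF that delivering it in characteristic
`p > M(d, n, l)` is exactly the named fact.

* `CanonicalResolutionDatum k n S` — a STRUCTURE (a type of evidence, not a claim): an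
  assignment of a multiple blow-up `seq U j` to every open immersion `j : U → 𝔸ⁿ_k` such that
  (a) `seq U j` is a resolution of the restricted marked ideal `j^*(𝔸ⁿ_k, 𝓘_Y, ∅, 1)`
  (Thm. 8.0.5, existence: "there is an associated resolution … called canonical", Def. 3.1.3);
  (b) for every further open immersion `g : V → U`, the induced sequence `(seq U j)|V` is an
  extension of `seq V (g ≫ j)` (Thm. 8.0.5 (2): "For any étale morphism `φ : M' → M`, the
  induced sequence `(X'_i) = φ^*(X_i)` is an extension of the canonical resolution of
  `φ^*(X, 𝓘, E, μ)`", for the open immersions `φ = g`; Def. 3.1.5);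
  (c) if `Y` is integral and `j` meets `Y` inside its regular locus, `seq U j` is an extension of
  the one-step sequence blowing up `𝓘_Y|U` (the value of the canonical resolution on the ideal
  of a smooth irreducible subvariety with `E = ∅`, `μ = 1`: proof of Thm. 4.0.6 — `𝒩(𝓘_Z) = 𝓘_Z`
  of maximal order `1 = μ`, `O(𝓘_Z, 1) = 𝒞(ℋ(𝓘_Z, 1)) = (𝓘_Z, 1)`, Step 1b down to `Z` — whose
  output shape is `bierstoneGrigorievMilmanWlodarczyk2011_canonical_of_isRegular`,
  `CanonicalResolutionSmoothCentre.lean`).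
* `canonicalResolutionDatumOfIsRegular` — NON-VACUITY: for `Y = V(S)` regular the one-step
  sequences `U ↦ single (𝓘_Y|U)` form such a datum, in every characteristic
  (`CentreSeq.single_isResolutionOf`, `hasSNCWith_nil_of_isRegular`).
* `CanonicalResolutionDatum.inner` — PROVED: a datum yields the inner statement of the named
  fact for `(k, n, S)` (take `s = seq 𝔸ⁿ 𝟙`; (i) by (a) and `MarkedIdeal.comap_id`; (ii) by (b)
  for `j`, (c) for `j`, and transitivity `IsExtensionOf.isExtensionOfSingle`).
* `bierstoneGrigorievMilmanWlodarczyk2011_canonical_of_datum` — PROVED: **if for some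
  `M : ℕ → ℕ → ℕ → ℕ` every input `(k, n, S)` with `|S| ≤ l`, degrees `≤ d` and
  `M(d, n, l) < p = char k`, `k` perfect, carries a `CanonicalResolutionDatum`, then
  `BierstoneGrigorievMilmanWlodarczyk2011_canonical` holds.** This is the assembly step; what
  it consumes is Thm. 8.0.5 itself (the algorithm with its functoriality (2) for open
  immersions) together with Lemma 8.0.3 (1) (`M̄ ≤ M(d, n, l)`) and the identification (c).
* The datum form is an INTERFACE EQUIVALENT to the named fact, not a lower layer of its
  decomposition: conversely a global sequence with (i) ∧ (ii) restricts to a datum `U ↦ s|U`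
  (functoriality under the open immersions between opens of `𝔸ⁿ_k` is free for restrictions of
  one sequence, Def. 3.1.5 Remark (1)), so `Nonempty (CanonicalResolutionDatum k n S)` ↔ the
  inner statement of the fact for `(k, n, S)`, and "data in characteristic `p > M(d, n, l)`" ↔
  `BierstoneGrigorievMilmanWlodarczyk2011_canonical` — PROVED in the companion
  `CanonicalResolutionDatumProofs.lean` (`CanonicalResolutionDatum.nonempty_iff_inner`,
  `canonicalDatum_iff_canonical`). Accordingly "data in large characteristic" is NOT vendored as
  a named fact of its own (an earlier revision named it
  `BierstoneGrigorievMilmanWlodarczyk2011_canonicalDatum`; equivalent to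
  `BierstoneGrigorievMilmanWlodarczyk2011_canonical`, it was merged back into that fact, D-0026):
  the one named fact on this line stays `BierstoneGrigorievMilmanWlodarczyk2011_canonical`, and
  below it lies the resolution algorithm (§4) with the characteristic control of §8 (size XL).

## Sources

* E. Bierstone, D. Grigoriev, P. Milman, J. Włodarczyk, arXiv:1206.3090 (arXiv numbering):
  Defs. 3.1.3–3.1.5 (p. 6), §4 proof of Thm. 4.0.6 (pp. 11–13), Lemma 8.0.3 (1), Thm. 8.0.5,
  Remark, Cor. 8.0.6–8.0.7 (p. 23). [BierstoneGrigorievMilmanWlodarczyk2011]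

## Design notes

* `seq` takes the open immersion property as an explicit argument (`IsOpenImmersion j →`) so
  that the structure fields can quantify over it; instances are re-installed with `haveI` where
  `restrict` needs them.
* Clause (b) is Thm. 8.0.5 (2) restricted to open immersions between open subschemes of `𝔸ⁿ_k`,
  which is all that clause (ii) of the named fact consumes; clause (1) (surjective étale
  invariance) and étale (2) are not part of the interface.
-/

noncomputable section

open CategoryTheory CategoryTheory.Limits AlgebraicGeometry TopologicalSpace Topology

namespace Literature.AlgebraicGeometry.Resolution

universe u

/-- The marked ideal `(𝔸ⁿ_k, 𝓘_Y, ∅, 1)` of BGMW Cor. 8.0.6 / 8.0.7, `Y = V(S)`, `𝓘_Y` the kernel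
of `V(S) ↪ 𝔸ⁿ_k`. [cite: BierstoneGrigorievMilmanWlodarczyk2011, Cor. 8.0.6–8.0.7 with §4, Remarks (3) (p. 13)] -/
def affineMarkedIdeal (k : Type) [Field k] (n : ℕ) (S : Finset (MvPolynomial (Fin n) k)) :
    MarkedIdeal (Spec (CommRingCat.of (MvPolynomial (Fin n) k))) :=
  ⟨(affineZeroLocusι k n S).ker, [], 1⟩

/-- Unfolding. [folklore] -/
@[simp] theorem affineMarkedIdeal_ideal (k : Type) [Field k] (n : ℕ)
    (S : Finset (MvPolynomial (Fin n) k)) :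
    (affineMarkedIdeal k n S).ideal = (affineZeroLocusι k n S).ker := rfl

/-- Unfolding. [folklore] -/
@[simp] theorem affineMarkedIdeal_boundary (k : Type) [Field k] (n : ℕ)
    (S : Finset (MvPolynomial (Fin n) k)) : (affineMarkedIdeal k n S).boundary = [] := rfl

/-- Unfolding. [folklore] -/
@[simp] theorem affineMarkedIdeal_mult (k : Type) [Field k] (n : ℕ)
    (S : Finset (MvPolynomial (Fin n) k)) : (affineMarkedIdeal k n S).mult = 1 := rfl

/-- **The output of BGMW Thm. 8.0.5 (with the identification of the canonical resolution of a
smooth centre) for the marked ideal `(𝔸ⁿ_k, 𝓘_Y, ∅, 1)`, `Y = V(S)`, as a datum**: to every open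
immersion `j : U → 𝔸ⁿ_k` a multiple blow-up `seq U j` of `U` such that (a) `seq U j` resolves
`j^*(𝔸ⁿ_k, 𝓘_Y, ∅, 1)` (Thm. 8.0.5, existence; Def. 3.1.3), (b) for every open immersion
`g : V → U` the induced sequence `(seq U j)|V` is an extension of `seq V (g ≫ j)` (Thm. 8.0.5 (2)
for open immersions; Def. 3.1.5), and (c) if `Y` is integral and `j` meets `Y` inside its
regular locus then `seq U j` extends the one-step sequence along `𝓘_Y|U` (the canonical
resolution of the ideal of a smooth irreducible subvariety, proof of Thm. 4.0.6). A type of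
EVIDENCE consumed by `bierstoneGrigorievMilmanWlodarczyk2011_canonical_of_datum`; inhabited
for regular `Y` by `canonicalResolutionDatumOfIsRegular`.
[cite: BierstoneGrigorievMilmanWlodarczyk2011, Thm. 8.0.5 (existence, (2)) with Defs. 3.1.3, 3.1.5 and §4 proof of Thm. 4.0.6] -/
structure CanonicalResolutionDatum (k : Type) [Field k] (n : ℕ)
    (S : Finset (MvPolynomial (Fin n) k)) : Type 1 where
  /-- the sequence assigned to the open immersion `j : U → 𝔸ⁿ_k` -/
  seq : ∀ (U : Scheme.{0}) (j : U ⟶ Spec (CommRingCat.of (MvPolynomial (Fin n) k))),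
    IsOpenImmersion j → CentreSeq U
  /-- (a) it resolves the restricted marked ideal `j^*(𝔸ⁿ_k, 𝓘_Y, ∅, 1)` -/
  isResolutionOf : ∀ (U : Scheme.{0}) (j : U ⟶ Spec (CommRingCat.of (MvPolynomial (Fin n) k)))
    (hj : IsOpenImmersion j), (seq U j hj).IsResolutionOf ((affineMarkedIdeal k n S).comap j)
  /-- (b) Thm. 8.0.5 (2) for open immersions: the induced sequence on a smaller open is an
  extension of the sequence assigned to it -/
  restrict_isExtensionOf : ∀ (U : Scheme.{0})
    (j : U ⟶ Spec (CommRingCat.of (MvPolynomial (Fin n) k))) (hj : IsOpenImmersion j)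
    (V : Scheme.{0}) (g : V ⟶ U) (hg : IsOpenImmersion g),
    ((seq U j hj).restrict g).IsExtensionOf (seq V (g ≫ j) inferInstance)
  /-- (c) over the regular locus of an integral `Y`, the sequence extends the blow-up of `Y ∩ U` -/
  isExtensionOfSingle : ∀ (U : Scheme.{0})
    (j : U ⟶ Spec (CommRingCat.of (MvPolynomial (Fin n) k))) (hj : IsOpenImmersion j),
    IsIntegral (affineZeroLocus k n S) →
    (∃ y : affineZeroLocus k n S, affineZeroLocusι k n S y ∈ Set.range j) →
    (∀ y : affineZeroLocus k n S, affineZeroLocusι k n S y ∈ Set.range j →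
      IsRegularLocalRing ((affineZeroLocus k n S).presheaf.stalk y)) →
    (seq U j hj).IsExtensionOfSingle ((affineZeroLocusι k n S).ker.comap j)

namespace CanonicalResolutionDatum

variable {k : Type} [Field k] {n : ℕ} {S : Finset (MvPolynomial (Fin n) k)}

/-- The global sequence of the datum: the one assigned to `𝟙 : 𝔸ⁿ_k → 𝔸ⁿ_k`. [folklore] -/
def global (D : CanonicalResolutionDatum k n S) :
    CentreSeq (Spec (CommRingCat.of (MvPolynomial (Fin n) k))) :=
  D.seq _ (𝟙 _) inferInstance

/-- (i) of the named fact: the global sequence resolves `(𝔸ⁿ_k, 𝓘_Y, ∅, 1)`.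
[cite: BierstoneGrigorievMilmanWlodarczyk2011, Thm. 8.0.5 (existence)] -/
theorem global_isResolutionOf (D : CanonicalResolutionDatum k n S) :
    D.global.IsResolutionOf ⟨(affineZeroLocusι k n S).ker, [], 1⟩ := by
  have h := D.isResolutionOf _ (𝟙 _) inferInstance
  rwa [show affineMarkedIdeal k n S = ⟨(affineZeroLocusι k n S).ker, [], 1⟩ from rfl,
    MarkedIdeal.comap_id] at h

/-- (ii) of the named fact: over the regular locus of an integral `Y`, the global sequence
restricts to an extension of the blow-up of `Y ∩ U` — (b) for `j`, (c) for `j`, and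
transitivity of extensions (`IsExtensionOf.isExtensionOfSingle`).
[cite: BierstoneGrigorievMilmanWlodarczyk2011, Thm. 8.0.5 (2) with §4 proof of Thm. 4.0.6] -/
theorem global_restrict_isExtensionOfSingle (D : CanonicalResolutionDatum k n S)
    (hint : IsIntegral (affineZeroLocus k n S)) {U : Scheme.{0}}
    (j : U ⟶ Spec (CommRingCat.of (MvPolynomial (Fin n) k))) [hj : IsOpenImmersion j]
    (hmeet : ∃ y : affineZeroLocus k n S, affineZeroLocusι k n S y ∈ Set.range j)
    (hreg : ∀ y : affineZeroLocus k n S, affineZeroLocusι k n S y ∈ Set.range j →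
      IsRegularLocalRing ((affineZeroLocus k n S).presheaf.stalk y)) :
    (D.global.restrict j).IsExtensionOfSingle ((affineZeroLocusι k n S).ker.comap j) := by
  have hb := D.restrict_isExtensionOf _ (𝟙 _) inferInstance U j hj
  have hc := D.isExtensionOfSingle U (j ≫ 𝟙 _) inferInstance hint
    (by simpa using hmeet) (by simpa using hreg)
  have h := hb.isExtensionOfSingle hc
  rw [Category.comp_id] at h
  exact h

/-- **A datum yields the inner statement of `BierstoneGrigorievMilmanWlodarczyk2011_canonical`
for the input `(k, n, S)`.** [cite: BierstoneGrigorievMilmanWlodarczyk2011, Thm. 8.0.5 with Cor. 8.0.6–8.0.7] -/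
theorem inner (D : CanonicalResolutionDatum k n S) :
    ∃ s : CentreSeq (Spec (CommRingCat.of (MvPolynomial (Fin n) k))),
      s.IsResolutionOf ⟨(affineZeroLocusι k n S).ker, [], 1⟩ ∧
      (IsIntegral (affineZeroLocus k n S) →
        ∀ (U : Scheme.{0}) (j : U ⟶ Spec (CommRingCat.of (MvPolynomial (Fin n) k)))
          [IsOpenImmersion j],
          (∃ y : affineZeroLocus k n S, affineZeroLocusι k n S y ∈ Set.range j) →
          (∀ y : affineZeroLocus k n S, affineZeroLocusι k n S y ∈ Set.range j →
            IsRegularLocalRing ((affineZeroLocus k n S).presheaf.stalk y)) →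
            (s.restrict j).IsExtensionOfSingle ((affineZeroLocusι k n S).ker.comap j)) :=
  ⟨D.global, D.global_isResolutionOf, fun hint _ j _ hmeet hreg =>
    D.global_restrict_isExtensionOfSingle hint j hmeet hreg⟩

end CanonicalResolutionDatum

/-! ## Non-vacuity: the datum for regular `Y` -/

/-- **For `Y = V(S)` regular, the one-step sequences `U ↦ single (𝓘_Y|U)` form a canonical
resolution datum**, in every characteristic: `single (j^*𝓘_Y)` resolves `j^*(𝔸ⁿ_k, 𝓘_Y, ∅, 1)`
(`U` and `V(j^*𝓘_Y) = Y ∩ U` regular, `hasSNCWith_nil_of_isRegular`,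
`CentreSeq.single_isResolutionOf`), restricts to `single ((g ≫ j)^*𝓘_Y)`, and extends itself.
[cite: BierstoneGrigorievMilmanWlodarczyk2011, Thm. 8.0.5 with §4 proof of Thm. 4.0.6 (smooth centre)] -/
def canonicalResolutionDatumOfIsRegular (k : Type) [Field k] (n : ℕ)
    (S : Finset (MvPolynomial (Fin n) k)) (hY : Scheme.IsRegular (affineZeroLocus k n S)) :
    CanonicalResolutionDatum k n S where
  seq U j _ := CentreSeq.single ((affineZeroLocusι k n S).ker.comap j)
  isResolutionOf U j hj := by
    haveI := hj
    have hA : Scheme.IsRegular (Spec (CommRingCat.of (MvPolynomial (Fin n) k))) :=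
      Scheme.isRegular_Spec _
    have hC : Scheme.IsRegular ((affineZeroLocusι k n S).ker.comap j).subscheme :=
      Scheme.IsRegular.subscheme_comap_of_etale j _
        (isRegular_subscheme_ker_affineZeroLocusι k n S hY)
    haveI : IsLocallyNoetherian U := LocallyOfFiniteType.isLocallyNoetherian j
    exact CentreSeq.single_isResolutionOf
      (hasSNCWith_nil_of_isRegular (Scheme.IsRegular.of_isOpenImmersion j hA) hC) hC
  restrict_isExtensionOf U j hj V g hg := by
    haveI := hg
    change ((CentreSeq.single ((affineZeroLocusι k n S).ker.comap j)).restrict g).IsExtensionOf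
      (CentreSeq.single ((affineZeroLocusι k n S).ker.comap (g ≫ j)))
    rw [CentreSeq.restrict_single, ← Scheme.IdealSheafData.comap_comp]
    exact CentreSeq.IsExtensionOf.refl _
  isExtensionOfSingle U j _ _ _ _ := CentreSeq.isExtensionOfSingle_single _

/-! ## The assembly: data in large characteristic ⇒ the named fact -/

/-- **`BierstoneGrigorievMilmanWlodarczyk2011_canonical` from canonical resolution data in
characteristic `p > M(d, n, l)`**: if some `M : ℕ → ℕ → ℕ → ℕ` is such that every
`Y = V(S) ⊆ 𝔸ⁿ_k` with `|S| ≤ l`, degrees `≤ d`, `k` perfect of characteristic `p > M(d, n, l)`,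
carries a `CanonicalResolutionDatum` (BGMW Thm. 8.0.5 applied to the opens of `𝔸ⁿ_k` — all of
multiplicity bound `M̄ ≤ M(d, n, l) < p` by Lemma 8.0.3 (1) — together with (2) for the open
immersions between them and the value on smooth irreducible centres), then the named fact holds.
The remaining (XL) input below this theorem is the resolution algorithm itself.
[cite: BierstoneGrigorievMilmanWlodarczyk2011, Thm. 8.0.5 with Lemma 8.0.3 (1), Remark and Cor. 8.0.6–8.0.7 (p. 23)] -/
theorem bierstoneGrigorievMilmanWlodarczyk2011_canonical_of_datum
    (h : ∃ M : ℕ → ℕ → ℕ → ℕ, ∀ (p : ℕ), p.Prime →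
      ∀ (k : Type) [Field k] [CharP k p] [PerfectField k] (n d l : ℕ)
        (S : Finset (MvPolynomial (Fin n) k)),
        S.card ≤ l → (∀ f ∈ S, f.totalDegree ≤ d) → M d n l < p →
          Nonempty (CanonicalResolutionDatum k n S)) :
    BierstoneGrigorievMilmanWlodarczyk2011_canonical := by
  obtain ⟨M, hM⟩ := h
  refine ⟨M, fun p hp k _ _ _ n d l S hS hd hMp => ?_⟩
  obtain ⟨D⟩ := hM p hp k n d l S hS hd hMp
  exact D.inner

end Literature.AlgebraicGeometry.Resolution

end
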